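import Summits.Ventures.PercRepro.SMC4

/-!
# PercRepro — the published benchmark inequalities as named Props (typer-2, gen 3)

`conjectures/BENCHMARKS.md` (p2, D5) tests published theorems and open conjectures on the exact
census.  This file states them in the cell's language, 1-1 with the rows of that table, so that a
theorem or a counterexample can be recorded against the TYPED statement (as `not_H4` does for the
planted control).  Nothing here is proved; the rows marked THEOREM are theorems of the cited
papers, the rows marked OPEN are open conjectures there.  Notation of the table for an ordered
marked triple `(a, b, c)`: `T = P(abc)`, `P1 = P(ab|c)`, `P2 = P(ac|b)`, `P3 = P(bc|a)`,
`B = P(a|b|c)` — the five rows `G.law3 p a b c 0, …, 4` (`SMC.lean`).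

* `G.connSomeEvent s A` — `{s ↔ A}`: `s` is joined to SOME vertex of `A`;
* **`KN24Conj1`**, **`KN24Conj2`**, **`KN24Eq3`**, **`KN24Conj4Card`** — Kozma–Nitzan,
  arXiv:2401.12397, Conjectures 1, 2, eq. (3), Conjecture 4 (with `f = |C|`) — OPEN;
* **`Gladkov24Thm11`** (`8·P(ab)P(ac)P(bc) ≥ P(abc)²`), **`Gladkov24Thm62`**
  (`2·P(a~b ∨ a~c)²·P(b~c) ≥ P(abc)²`), **`Gladkov24Lemma12`** — Gladkov, arXiv:2408.08457 —
  THEOREMS;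
* **`GZ24Final`**, **`GZ24Computer`** — Gladkov–Zimin, arXiv:2404.08873, eqs. (final),
  (computer) — THEOREMS;
* `k = 4` (rows of `G.law4 p a b c d`, `SMC4.lean`, BENCHMARKS.md §B2): **`GZ24Thm33`**,
  **`GZ24Cor34`**, **`GZ24Cor35`** (Gladkov–Zimin, «On Harris–Kleitman type inequalities»,
  Sept 2024, Thm 3.3 (7), Cor 3.4 (8), Cor 3.5) and **`GZ24HC43`** (arXiv:2404.08873, Thm 3.2,
  the (hc) inequality with `λ = 4/3`) — THEOREMS.
Not typed: Richards 2004 (RICH — the general statement is not in the dossier), Gladkov Conj 1.4 /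
10.2 (needs edge-disjoint path counts, not tested by the engine either).
-/

namespace PercRepro

open Finset

namespace MultiGraph

variable {V E : Type*} (G : MultiGraph V E)

/-- `{s ↔ A}`: the vertex `s` is joined by an open path to SOME vertex of `A`. -/
def connSomeEvent (s : V) (A : Set V) : Set (Config E) := {ω | ∃ a ∈ A, G.Conn ω s a}

/-- Membership in `{s ↔ A}`. -/
theorem mem_connSomeEvent {s : V} {A : Set V} {ω : Config E} :
    ω ∈ G.connSomeEvent s A ↔ ∃ a ∈ A, G.Conn ω s a := Iff.rfl

/-- `{s ↔ A}` is the union of the pair events. -/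
theorem connSomeEvent_eq (s : V) (A : Set V) :
    G.connSomeEvent s A = ⋃ a ∈ A, G.connEvent s a := by
  ext ω; simp [connSomeEvent, connEvent]

/-- `{s ↔ A}` is increasing. -/
theorem isUpperSet_connSomeEvent (s : V) (A : Set V) : IsUpperSet (G.connSomeEvent s A) := by
  intro ω ω' h hω
  obtain ⟨a, ha, hc⟩ := hω
  exact ⟨a, ha, hc.mono h⟩

/-- `{s ↔ {a}} = {s ↔ a}`. -/
theorem connSomeEvent_singleton (s a : V) : G.connSomeEvent s {a} = G.connEvent s a := by
  ext ω; simp [connSomeEvent, connEvent]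

end MultiGraph

/-! ### Kozma–Nitzan (arXiv:2401.12397) — OPEN -/

/-- **[KN24] Conjecture 1** (Kozma–Nitzan, arXiv:2401.12397, eq. (1), "post-FKG"): for every
finite multigraph, every `p ∈ [0,1]^E`, vertices `s, b` and nonempty finite `A`,
`P(s ↔ A) · min_{a ∈ A} P(a ↔ b) ≤ P(s ↔ b)`.  BENCHMARKS.md row KN1: 0 / 1,719,036 on `n ≤ 6`.
Implies `θ(p_c) = 0` on `ℤ^d` (their Theorem); proved there only for `|A| = 2`. -/
def KN24Conj1 : Prop :=
  ∀ {V E : Type} [Fintype E] [DecidableEq E] (G : MultiGraph V E) (p : E → ℝ), IsProb p →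
    ∀ (s b : V) (A : Finset V) (hA : A.Nonempty),
      prob p (G.connSomeEvent s A) * A.inf' hA (fun a => prob p (G.connEvent a b)) ≤
        prob p (G.connEvent s b)

/-- **[KN24] Conjecture 2** (eq. (2), "pre-FKG"): `min_{a ∈ A} P(s ↔ A, a ↔ b) ≤ P(s ↔ b)`.
Row KN2: 0 / 1,719,036. -/
def KN24Conj2 : Prop :=
  ∀ {V E : Type} [Fintype E] [DecidableEq E] (G : MultiGraph V E) (p : E → ℝ), IsProb p →
    ∀ (s b : V) (A : Finset V) (hA : A.Nonempty),
      A.inf' hA (fun a => prob p (G.connSomeEvent s A ∩ G.connEvent a b)) ≤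
        prob p (G.connEvent s b)

/-- **[KN24] eq. (3)** (formally stronger than Conjecture 2):
`min_{a ∈ A} P(s ↔ A, a ↔ b) ≤ P(s ↔ b, s ↔ A)`.  Row KN3: 0 / 1,719,036. -/
def KN24Eq3 : Prop :=
  ∀ {V E : Type} [Fintype E] [DecidableEq E] (G : MultiGraph V E) (p : E → ℝ), IsProb p →
    ∀ (s b : V) (A : Finset V) (hA : A.Nonempty),
      A.inf' hA (fun a => prob p (G.connSomeEvent s A ∩ G.connEvent a b)) ≤
        prob p (G.connEvent s b ∩ G.connSomeEvent s A)

/-- **[KN24] Conjecture 4** with the monotone cluster property `f = |C|`: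
`min_{a ∈ A} E[|C(a)| · 1{s ↔ A}] ≤ E[|C(s)| · 1{s ↔ A}]`.  Row KN4[|C|]: 0 / 351,010.
(Their Theorem 10: this implies Conjecture 2.) -/
def KN24Conj4Card : Prop :=
  ∀ {V E : Type} [Fintype V] [Fintype E] [DecidableEq E] (G : MultiGraph V E) (p : E → ℝ),
    IsProb p → ∀ (s : V) (A : Finset V) (hA : A.Nonempty),
      A.inf' hA (fun a => expect p
          ((G.connSomeEvent s A).indicator fun ω => ((G.cluster ω a).ncard : ℝ))) ≤
        expect p ((G.connSomeEvent s A).indicator fun ω => ((G.cluster ω s).ncard : ℝ))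

/-! ### Gladkov (arXiv:2408.08457) and Gladkov–Zimin (arXiv:2404.08873) at `k = 3` — THEOREMS -/

/-- **Gladkov 2024, Theorem 1.1 / (13)**: `P(abc)² ≤ 8 · P(ab) · P(ac) · P(bc)` for every three
vertices of a finite multigraph.  Row Gl13: 0 / 104,280. -/
def Gladkov24Thm11 : Prop :=
  ∀ {V E : Type} [Fintype E] [DecidableEq E] (G : MultiGraph V E) (p : E → ℝ), IsProb p →
    ∀ a b c : V,
      prob p (G.connEvent a b ∩ G.connEvent b c) ^ 2 ≤
        8 * prob p (G.connEvent a b) * prob p (G.connEvent a c) * prob p (G.connEvent b c)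

/-- **Gladkov 2024, Theorem 6.2 / (14)**: `P(abc)² ≤ 2 · P(a~b ∨ a~c)² · P(b~c)`.
Row Gl14: 0 / 104,280. -/
def Gladkov24Thm62 : Prop :=
  ∀ {V E : Type} [Fintype E] [DecidableEq E] (G : MultiGraph V E) (p : E → ℝ), IsProb p →
    ∀ a b c : V,
      prob p (G.connEvent a b ∩ G.connEvent b c) ^ 2 ≤
        2 * prob p (G.connEvent a b ∪ G.connEvent a c) ^ 2 * prob p (G.connEvent b c)

/-- **Gladkov 2024, Lemma 1.2, eq. (2)** in the rows `T, P1, P2, P3, B` of the marked triple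
`(a, b, c)`: `B²/(B + P2) + B²/(B + P1) ≤ B + (B + P3)²` (a term with zero denominator is `0`,
Lean's convention — then `B = 0` and the term vanishes in the paper too).  Row GlL12: 0 / 104,280,
11,198 nontrivial equalities. -/
def Gladkov24Lemma12 : Prop :=
  ∀ {V E : Type} [Fintype E] [DecidableEq E] (G : MultiGraph V E) (p : E → ℝ), IsProb p →
    ∀ a b c : V, [a, b, c].Nodup →
      G.law3 p a b c 4 ^ 2 / (G.law3 p a b c 4 + G.law3 p a b c 2) +
          G.law3 p a b c 4 ^ 2 / (G.law3 p a b c 4 + G.law3 p a b c 1) ≤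
        G.law3 p a b c 4 + (G.law3 p a b c 4 + G.law3 p a b c 3) ^ 2

/-- **Gladkov–Zimin, eq. (final)**: `(B + P3)(T + P1 + P2) ≤ P1 + P2 + P3`, i.e.
`P(a≁b ∧ a≁c) · P(a~b ∨ a~c) ≤ P(exactly two blocks)`.  Row GZfinal: 0 / 104,280. -/
def GZ24Final : Prop :=
  ∀ {V E : Type} [Fintype E] [DecidableEq E] (G : MultiGraph V E) (p : E → ℝ), IsProb p →
    ∀ a b c : V, [a, b, c].Nodup →
      (G.law3 p a b c 4 + G.law3 p a b c 3) * (G.law3 p a b c 0 + G.law3 p a b c 1 + G.law3 p a b c 2) ≤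
        G.law3 p a b c 1 + G.law3 p a b c 2 + G.law3 p a b c 3

/-- **Gladkov–Zimin, eq. (computer)** (computer-assisted LP proof):
`(B + P3)(T + P1 + P2) ≤ P1 + P2 + P3 − P1² − P2²`.  Row GZcomp: 0 / 104,280. -/
def GZ24Computer : Prop :=
  ∀ {V E : Type} [Fintype E] [DecidableEq E] (G : MultiGraph V E) (p : E → ℝ), IsProb p →
    ∀ a b c : V, [a, b, c].Nodup →
      (G.law3 p a b c 4 + G.law3 p a b c 3) * (G.law3 p a b c 0 + G.law3 p a b c 1 + G.law3 p a b c 2) ≤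
        G.law3 p a b c 1 + G.law3 p a b c 2 + G.law3 p a b c 3 -
          G.law3 p a b c 1 ^ 2 - G.law3 p a b c 2 ^ 2

/-! ### Gladkov–Zimin at `k = 4` — THEOREMS (BENCHMARKS.md §B2, rows of `law4`:
`0 = abcd`, `1 = abc|d`, `2 = abd|c`, `3 = ab|cd`, `4 = ab|c|d`, `5 = acd|b`, `6 = ac|bd`,
`7 = ac|b|d`, `8 = ad|bc`, `9 = a|bcd`, `10 = a|bc|d`, `11 = ad|b|c`, `12 = a|bd|c`,
`13 = a|b|cd`, `14 = a|b|c|d`) -/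

/-- **Gladkov–Zimin Sept 2024, Theorem 3.3, eq. (7)** (strengthened Harris for two pairs):
`P(a~b)·P(c~d) + P(a~b ∨ c~d)·(x₂ + x₃) + x₂·x₃ ≤ P(a~b ∧ c~d)`, `x₂ = ac|bd`, `x₃ = ad|bc`.
Row GZ33: 0 / 328,680. -/
def GZ24Thm33 : Prop :=
  ∀ {V E : Type} [Fintype E] [DecidableEq E] (G : MultiGraph V E) (p : E → ℝ), IsProb p →
    ∀ a b c d : V, [a, b, c, d].Nodup →
      prob p (G.connEvent a b) * prob p (G.connEvent c d) +
          prob p (G.connEvent a b ∪ G.connEvent c d) * (G.law4 p a b c d 6 + G.law4 p a b c d 8) +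
          G.law4 p a b c d 6 * G.law4 p a b c d 8 ≤
        prob p (G.connEvent a b ∩ G.connEvent c d)

/-- **Gladkov–Zimin Sept 2024, Corollary 3.4, eq. (8)** (the vdBHK06 poset conditioned on `a|b`):
`x₃·x₂ + (x₃ + x₂)·(bot + w_cd) ≤ (y_acd + w_ad + w_ac)·(w_bc + w_bd + y_bcd)`.
Row GZ34: 0 / 328,680. -/
def GZ24Cor34 : Prop :=
  ∀ {V E : Type} [Fintype E] [DecidableEq E] (G : MultiGraph V E) (p : E → ℝ), IsProb p →
    ∀ a b c d : V, [a, b, c, d].Nodup →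
      G.law4 p a b c d 8 * G.law4 p a b c d 6 +
          (G.law4 p a b c d 8 + G.law4 p a b c d 6) * (G.law4 p a b c d 14 + G.law4 p a b c d 13) ≤
        (G.law4 p a b c d 5 + G.law4 p a b c d 11 + G.law4 p a b c d 7) *
          (G.law4 p a b c d 10 + G.law4 p a b c d 12 + G.law4 p a b c d 9)

/-- **Gladkov–Zimin Sept 2024, Corollary 3.5** (the pair-sum conditioned on `a|d ∧ b|d ∧ c|d`):
`w_ab·w_ac + w_ab·w_bc + w_ac·w_bc ≤ y_abc·bot`.  Row GZ35: 0 / 328,680. -/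
def GZ24Cor35 : Prop :=
  ∀ {V E : Type} [Fintype E] [DecidableEq E] (G : MultiGraph V E) (p : E → ℝ), IsProb p →
    ∀ a b c d : V, [a, b, c, d].Nodup →
      G.law4 p a b c d 4 * G.law4 p a b c d 7 + G.law4 p a b c d 4 * G.law4 p a b c d 10 +
          G.law4 p a b c d 7 * G.law4 p a b c d 10 ≤
        G.law4 p a b c d 1 * G.law4 p a b c d 14

/-- **Gladkov–Zimin arXiv:2404.08873, proof of Theorem 3.2, inequality (hc) with `λ = 4/3`**:
`P(abcd) ≤ P(some pair among a, b, c, d connected)²`, i.e. `top ≤ (1 − bot)²`.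
Row HC43: 0 / 328,680. -/
def GZ24HC43 : Prop :=
  ∀ {V E : Type} [Fintype E] [DecidableEq E] (G : MultiGraph V E) (p : E → ℝ), IsProb p →
    ∀ a b c d : V, [a, b, c, d].Nodup →
      G.law4 p a b c d 0 ≤ (1 - G.law4 p a b c d 14) ^ 2

/-- The computer-assisted form is the stronger one. -/
theorem GZ24Final_of_GZ24Computer (h : GZ24Computer) : GZ24Final := by
  intro V E _ _ G p hp a b c hn
  have key := h G p hp a b c hn
  nlinarith [sq_nonneg (G.law3 p a b c 1), sq_nonneg (G.law3 p a b c 2)]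

/-- Eq. (3) is formally stronger than Conjecture 2 (`P(s ↔ b, s ↔ A) ≤ P(s ↔ b)`). -/
theorem KN24Conj2_of_KN24Eq3 (h : KN24Eq3) : KN24Conj2 := by
  intro V E _ _ G p hp s b A hA
  exact (h G p hp s b A hA).trans (prob_mono hp Set.inter_subset_left)

end PercRepro
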